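import Literature.AlgebraicGeometry.Frobenioids.PerfectionStandardTypes
import Literature.AlgebraicGeometry.Frobenioids.PerfectionPullbackMorphisms
import Mathlib.CategoryTheory.Endomorphism
import HarnessLib

/-!
# Frobenioids I, Proposition 5.5 (iii) for `C^pf`, clause (b) of Definition 3.1 (i): Frobenius-compactness
# of the image `(A, 1)` of a Frobenius-compact isotropic object — reduction to Prop. 5.5 (i) and a descent
# hypothesis

Mochizuki, *The geometry of Frobenioids I: the general theory*, Kyushu J. Math. **62** (2008)
293–400, Prop. 5.5 (iii) p. 104, proof p. 105 ll. 17–18: "by assertion (i), if … `A ∈ Ob((C^*)^istr)`,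
then `O^▷(−)` of the image of `A` in `(C^*)^pf` is the perfection of `O^▷(A)`" — the printed route to
clause (b) of Def. 3.1 (i) ("if `C^pf` is of group-like type then `(C^pf)^istr` admits a Frobenius-compact
object", Def. 1.2 (iv) p. 23) [cite: MochizukiFrdI2008, Prop. 5.5 (iii) p.104].

PROOF-ONLY file (cell abc-iut, row `FrdI:Prop5.5(iii)/P55-L06`, GAP row `G-w5d042-1 (P55-L06-b)`, seat
abc-iut-w5-d042; no new notions).  For an isotropic Frobenius-compact `A ∈ Ob(C)` and its image
`X = (A, 1)` under `C → C^pf = Perfection.toPf hF`, GIVEN Prop. 5.5 (i) BY NAME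
(`h₁ : FrdI.Prop55Sub.Prop55i F hF A`, the multiplicative bijection `O^▷(A)^pf ⥲ O^▷(X)` extending
`α ↦ toPf(α)`): (1) `O^×(X)` is commutative and (2) `O^×(X)` has a non-torsion element (`toPf(u₀)` for a
non-torsion `u₀ ∈ O^×(A)`; `toPf` is injective on `O^×(A)` up to torsion).  Condition (3) of Def. 1.2 (iv)
("an automorphism of `X` acting on `O^×(X)^pf` by `λ = p/q ∈ ℚ_{>0}` acts trivially") quantifies over ALL
`f ∈ Aut_{C^pf}(X)`, which are classes of automorphisms of the Frobenius powers `A^{(c)}` and need not come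
from `Aut_C(A)`; print is silent here.  We prove (3) under the explicit DESCENT HYPOTHESIS
`hdesc : ∀ f : Aut X, ∃ M ≥ 1, ∃ f₀ : Aut A, f^M = toPf(f₀)`: if `f` acts by `p/q` then `f^M = toPf(f₀)` acts
by `p^M/q^M`, so `f₀` acts on `O^×(A)` by `p^M/q^M` up to torsion, Frobenius-compactness of `A` makes this
action trivial up to torsion, the non-torsion unit forces `p^M = q^M`, i.e. `p = q`, and then the hypothesis
on `f` itself reads `(f u f⁻¹)^{qN} = u^{qN}`.  Main theorem: `Perfection.isFrobeniusCompact_toPf_obj`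
(CONDITIONAL on `h₁` and `hdesc`, both disclosed; no `def … : Prop`); closer
`FrdI.Prop55Sub.prop55iii_pf_standard_of_descent` = the slot `Prop55iii_pf_standard F hF` GIVEN Prop. 3.2 (iii)
(`hPf`), Prop. 5.5 (i) (`h₁`) by name and the descent hypothesis — clause (b) of `prop55iii_pf_standard_of`
(`PerfectionStandardTypes.lean`) discharged to that extent.  No statement of the paper is restated or
strengthened; HONEST FRAMING: nothing here bears on [IUTchIII] Cor. 3.12.
-/

namespace Literature.AlgebraicGeometry.Frobenioids

open CategoryTheory Opposite

universe w v v' u u' v₂ u₂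

/-! ### Group-theoretic bookkeeping for Def. 1.2 (iv) -/

section Group

variable {G : Type u} [Group G]

/-- Conjugates by powers stay in a conjugation-stable subgroup. [cite: MochizukiFrdI2008, Def. 1.2 (iv) p.23] -/
theorem Subgroup.pow_conj_mem_of_conj_mem (U : Subgroup G) (f : G) (hU : ∀ u ∈ U, f * u * f⁻¹ ∈ U) :
    ∀ (M : ℕ), ∀ u ∈ U, f ^ M * u * (f ^ M)⁻¹ ∈ U := by
  intro M
  induction M with
  | zero => intro u hu; simpa using hu
  | succ M ih =>
    intro u hu
    have e : f ^ (M + 1) * u * (f ^ (M + 1))⁻¹ = f * (f ^ M * u * (f ^ M)⁻¹) * f⁻¹ := by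
      rw [pow_succ', mul_inv_rev]; simp only [mul_assoc]
    rw [e]
    exact hU _ (ih u hu)

/-- Iterating "conjugation by `f` acts on `U` by `λ = p/q` up to torsion": conjugation by `f^M` acts by
`p^M/q^M` up to torsion (Def. 1.2 (iv), "Frobenius-compact"). [cite: MochizukiFrdI2008, Def. 1.2 (iv) p.23] -/
theorem Subgroup.pow_conj_ratio_of_conj_ratio (U : Subgroup G) (f : G) (hU : ∀ u ∈ U, f * u * f⁻¹ ∈ U)
    (p q : ℕ) (h : ∀ u ∈ U, ∃ N : ℕ, 0 < N ∧ ((f * u * f⁻¹) ^ q) ^ N = (u ^ p) ^ N) :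
    ∀ (M : ℕ), ∀ u ∈ U, ∃ N : ℕ, 0 < N ∧ ((f ^ M * u * (f ^ M)⁻¹) ^ q ^ M) ^ N = (u ^ p ^ M) ^ N := by
  intro M
  induction M with
  | zero => intro u _; exact ⟨1, one_pos, by simp⟩
  | succ M ih =>
    intro u hu
    have hwU : f ^ M * u * (f ^ M)⁻¹ ∈ U := Subgroup.pow_conj_mem_of_conj_mem U f hU M u hu
    obtain ⟨N₁, hN₁, e₁⟩ := ih u hu
    obtain ⟨N₂, hN₂, e₂⟩ := h _ hwU
    refine ⟨N₁ * N₂, mul_pos hN₁ hN₂, ?_⟩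
    have hconj : f ^ (M + 1) * u * (f ^ (M + 1))⁻¹ = f * (f ^ M * u * (f ^ M)⁻¹) * f⁻¹ := by
      rw [pow_succ', mul_inv_rev]; simp only [mul_assoc]
    rw [hconj]
    set w := f ^ M * u * (f ^ M)⁻¹
    calc ((f * w * f⁻¹) ^ q ^ (M + 1)) ^ (N₁ * N₂)
        = (((f * w * f⁻¹) ^ q) ^ N₂) ^ (q ^ M * N₁) := by
          rw [← pow_mul, ← pow_mul, ← pow_mul]; congr 1; ring
      _ = ((w ^ p) ^ N₂) ^ (q ^ M * N₁) := by rw [e₂]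
      _ = ((w ^ q ^ M) ^ N₁) ^ (p * N₂) := by
          rw [← pow_mul, ← pow_mul, ← pow_mul, ← pow_mul]; congr 1; ring
      _ = ((u ^ p ^ M) ^ N₁) ^ (p * N₂) := by rw [e₁]
      _ = (u ^ p ^ (M + 1)) ^ (N₁ * N₂) := by
          rw [← pow_mul, ← pow_mul, ← pow_mul]; congr 1; ring

/-- A non-torsion element detects exponents: `u^{a k} = u^{b k}`, `k ≥ 1` ⇒ `a = b`.
[cite: MochizukiFrdI2008, Def. 1.2 (iv) p.23] -/
theorem eq_of_pow_mul_eq_of_forall_pow_ne_one {u : G} (hu : ∀ K : ℕ, 0 < K → u ^ K ≠ 1) {a b k : ℕ}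
    (hk : 0 < k) (h : u ^ (a * k) = u ^ (b * k)) : a = b := by
  by_contra hne
  rcases Nat.lt_or_gt_of_ne hne with hlt | hgt
  · have h' : u ^ (a * k) * 1 = u ^ (a * k) * u ^ ((b - a) * k) := by
      rw [mul_one, ← pow_add, ← Nat.add_mul, Nat.add_sub_cancel' hlt.le]; exact h
    exact hu _ (Nat.mul_pos (Nat.sub_pos_of_lt hlt) hk) (mul_left_cancel h').symm
  · have h' : u ^ (b * k) * 1 = u ^ (b * k) * u ^ ((a - b) * k) := by
      rw [mul_one, ← pow_add, ← Nat.add_mul, Nat.add_sub_cancel' hgt.le]; exact h.symm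
    exact hu _ (Nat.mul_pos (Nat.sub_pos_of_lt hgt) hk) (mul_left_cancel h').symm

/-- "Acts by `P/Q` up to torsion" and "acts trivially up to torsion" on a non-torsion `u` force `P = Q`.
[cite: MochizukiFrdI2008, Def. 1.2 (iv) p.23] -/
theorem ratio_eq_of_conj_trivial {g u : G} (hu : ∀ K : ℕ, 0 < K → u ^ K ≠ 1) {P Q N N' : ℕ}
    (hN : 0 < N) (hN' : 0 < N') (h1 : ((g * u * g⁻¹) ^ Q) ^ N = (u ^ P) ^ N)
    (h2 : (g * u * g⁻¹) ^ N' = u ^ N') : P = Q := by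
  refine eq_of_pow_mul_eq_of_forall_pow_ne_one hu (Nat.mul_pos hN hN') ?_
  calc u ^ (P * (N * N')) = ((u ^ P) ^ N) ^ N' := by rw [← pow_mul, ← pow_mul]
    _ = (((g * u * g⁻¹) ^ Q) ^ N) ^ N' := by rw [h1]
    _ = ((g * u * g⁻¹) ^ N') ^ (Q * N) := by
        rw [← pow_mul, ← pow_mul, ← pow_mul]; congr 1; ring
    _ = (u ^ N') ^ (Q * N) := by rw [h2]
    _ = u ^ (Q * (N * N')) := by rw [← pow_mul]; congr 1; ring

end Group

/-! ### Conjugates of units; functors on automorphism groups -/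

namespace PreFrobenioidData

variable {C : Type u} [Category.{v} C] {D : Type u'} [Category.{v'} D] (S : PreFrobenioidData.{w} C D)

/-- `O^×(A)` is stable under conjugation by `Aut_C(A)` (base-identity: `Base(f⁻¹ u f) = Base(f)⁻¹ Base(f)`;
linear: degrees multiply). [cite: MochizukiFrdI2008, Def. 1.2 (iv) p.23] -/
theorem conj_mem_unitsSubgroup {A : C} (f u : Aut A) (hu : u ∈ S.unitsSubgroup A) :
    f * u * f⁻¹ ∈ S.unitsSubgroup A := by
  obtain ⟨hb, hl⟩ := hu
  refine ⟨?_, ?_⟩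
  · change S.base.map (f.inv ≫ u.hom ≫ f.hom) = 𝟙 _
    change S.base.map u.hom = 𝟙 _ at hb
    rw [S.base.map_comp, S.base.map_comp, hb, Category.id_comp, ← S.base.map_comp, f.inv_hom_id,
      S.base.map_id]
  · change S.degFr (f.inv ≫ u.hom ≫ f.hom) = 1
    change S.degFr u.hom = 1 at hl
    have h1 : S.degFr (f.inv ≫ f.hom) = 1 := by rw [f.inv_hom_id, S.degFr_id]
    rw [S.degFr_comp] at h1
    rw [S.degFr_comp, S.degFr_comp, hl, one_mul, h1]

end PreFrobenioidData

namespace PreFrobenioid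

variable {D : Type u} [Category.{v} D] {Φ : Dᵒᵖ ⥤ CommMonCat.{w}}
  {C : Type u'} [Category.{v'} C] {F : C ⥤ ElemFrobenioid Φ}

namespace Perfection

/-- Powers in `Aut A` and in `End A` agree on `hom`. [cite: MochizukiFrdI2008, Def. 1.2 (iv) p.23] -/
theorem aut_pow_hom {A : C} (a : Aut A) : ∀ n : ℕ, (a ^ n : Aut A).hom = End.of a.hom ^ n
  | 0 => rfl
  | n + 1 => by
    rw [pow_succ, pow_succ, Aut.Aut_mul_def, Iso.trans_hom, End.mul_def, aut_pow_hom a n]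

variable {hF : IsFrobenioid F}

/-- **Clause (b) of Def. 3.1 (i) for `C^pf`, reduced to Prop. 5.5 (i) and descent of automorphisms**: for
`C` of Frobenius-isotropic and Frobenius-normalized type, an isotropic Frobenius-compact `A ∈ Ob(C)`,
GIVEN Prop. 5.5 (i) at `A` (`h₁`, by name) and GIVEN that every automorphism of `X = (A, 1)` in `C^pf`
has a positive power in the image of `Aut_C(A)` (`hdesc`), the object `X` is Frobenius-compact in `C^pf`.
[cite: MochizukiFrdI2008, Prop. 5.5 (iii) p.104] -/
theorem isFrobeniusCompact_toPf_obj (hiso : IsOfType (IsFrobeniusIsotropic F))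
    (hnorm : IsOfType (IsFrobeniusNormalized F)) {A : C} (h₁ : FrdI.Prop55Sub.Prop55i F hF A)
    (hA : IsIsotropic F A) (hcA : (PreFrobenioidData.ofFunctor Φ F).IsFrobeniusCompact A)
    (hdesc : ∀ f : Aut ((toPf hF).obj A), ∃ (M : ℕ) (f₀ : Aut A), 0 < M ∧ f ^ M = (toPf hF).mapIso f₀) :
    (ops hF).IsFrobeniusCompact ((toPf hF).obj A) := by
  letI : CommMonoid (endSubmonoid F A) := endCommMonoid F hF A
  obtain ⟨e, he⟩ := h₁ hiso hnorm hA
  obtain ⟨-, ⟨u₁, hu₁, hnt⟩, h3⟩ := hcA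
  -- `toPf` on automorphism groups
  let Ψ : Aut A →* Aut ((toPf hF).obj A) :=
    MonoidHom.mk' (fun a => (toPf hF).mapIso a) fun a b => (toPf hF).mapIso_trans b a
  have hΨ : ∀ a : Aut A, (Ψ a).hom = (toPf hF).map a.hom := fun _ => rfl
  -- `toPf` maps units of `A` to units of `X`
  have hmap : ∀ u ∈ unitsSubgroup F A, Ψ u ∈ (ops hF).unitsSubgroup ((toPf hF).obj A) := by
    intro u hu
    have h2 := (e (Frobenioids.Perfection.of _ ⟨u.hom, hu⟩)).2
    rw [he] at h2
    exact h2
  -- `toPf` is injective on units of `A` up to torsion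
  have hinj : ∀ a ∈ unitsSubgroup F A, ∀ b ∈ unitsSubgroup F A,
      Ψ a = Ψ b → ∃ K : ℕ, 0 < K ∧ a ^ K = b ^ K := by
    intro a ha b hb hab
    have h' : e (Frobenioids.Perfection.of _ ⟨a.hom, ha⟩) = e (Frobenioids.Perfection.of _ ⟨b.hom, hb⟩) :=
      Subtype.ext (by rw [he, he, ← hΨ, ← hΨ, hab])
    obtain ⟨K, hK⟩ := Frobenioids.Perfection.of_eq_of_iff.mp (e.injective h')
    refine ⟨K, K.pos, Iso.ext ?_⟩
    have hK' := congrArg Subtype.val hK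
    rw [SubmonoidClass.coe_pow, SubmonoidClass.coe_pow] at hK'
    rw [aut_pow_hom, aut_pow_hom]
    exact hK'
  refine ⟨?_, ?_, ?_⟩
  · -- (1) `O^×(X)` is commutative: `O^▷(X) ≅ O^▷(A)^pf` is
    intro u hu u' hu'
    obtain ⟨x, hx⟩ := e.surjective ⟨u.hom, hu⟩
    obtain ⟨y, hy⟩ := e.surjective ⟨u'.hom, hu'⟩
    have hc : (⟨u.hom, hu⟩ : (ops hF).endSubmonoid _) * ⟨u'.hom, hu'⟩ = ⟨u'.hom, hu'⟩ * ⟨u.hom, hu⟩ := by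
      rw [← hx, ← hy, ← map_mul, ← map_mul, mul_comm]
    exact Iso.ext (congrArg Subtype.val hc)
  · -- (2) a non-torsion unit: `toPf(u₁)`
    refine ⟨Ψ u₁, hmap u₁ hu₁, fun N hN hN1 => ?_⟩
    rw [← map_pow, ← one_pow N, ← map_one Ψ, ← map_pow] at hN1
    obtain ⟨K, hK, hKe⟩ := hinj _ (pow_mem hu₁ N) _ (pow_mem (one_mem _) N) hN1
    rw [one_pow, one_pow, ← pow_mul] at hKe
    exact hnt (N * K) (Nat.mul_pos hN hK) hKe
  · -- (3) an automorphism acting by `p/q` acts trivially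
    intro f p q hyp u hu
    obtain ⟨M, f₀, hM, hfM⟩ := hdesc f
    change f ^ M = Ψ f₀ at hfM
    have hU := PreFrobenioidData.conj_mem_unitsSubgroup (ops hF) f
    have iter := Subgroup.pow_conj_ratio_of_conj_ratio _ f hU p q hyp M
    -- transfer to `A` along `f^M = toPf(f₀)`
    have hypA : ∀ u₀ ∈ (PreFrobenioidData.ofFunctor Φ F).unitsSubgroup A, ∃ N : ℕ, 0 < N ∧
        ((f₀ * u₀ * f₀⁻¹) ^ ((q ^ M : ℕ+) : ℕ)) ^ N = (u₀ ^ ((p ^ M : ℕ+) : ℕ)) ^ N := by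
      intro u₀ hu₀
      obtain ⟨N, hN, hEq⟩ := iter _ (hmap u₀ hu₀)
      rw [hfM, ← map_inv, ← map_mul, ← map_mul, ← map_pow, ← map_pow, ← map_pow, ← map_pow] at hEq
      have hc : f₀ * u₀ * f₀⁻¹ ∈ unitsSubgroup F A :=
        (PreFrobenioidData.ofFunctor Φ F).conj_mem_unitsSubgroup f₀ u₀ hu₀
      obtain ⟨K, hK, hKe⟩ := hinj _ (pow_mem (pow_mem hc _) N) _ (pow_mem (pow_mem hu₀ _) N) hEq
      refine ⟨N * K, Nat.mul_pos hN hK, ?_⟩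
      rw [PNat.pow_coe, PNat.pow_coe, pow_mul, pow_mul]
      exact hKe
    have concA := h3 f₀ (p ^ M) (q ^ M) hypA
    -- `p^M = q^M` on the non-torsion unit `u₁`, hence `p = q`
    obtain ⟨N₁, hN₁, e₁⟩ := hypA u₁ hu₁
    obtain ⟨N₂, hN₂, e₂⟩ := concA u₁ hu₁
    rw [PNat.pow_coe, PNat.pow_coe] at e₁
    have hPQ : (p : ℕ) ^ M = (q : ℕ) ^ M := ratio_eq_of_conj_trivial hnt hN₁ hN₂ e₁ e₂
    have hpq : (p : ℕ) = (q : ℕ) := Nat.pow_left_injective hM.ne' hPQ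
    -- conclude for `f` itself
    obtain ⟨N, hN, hEq⟩ := hyp u hu
    refine ⟨q * N, Nat.mul_pos q.pos hN, ?_⟩
    rw [pow_mul, pow_mul, hEq, hpq]

end Perfection

end PreFrobenioid

/-! ### The slot of `Prop55Sub.lean` under Prop. 3.2 (iii), Prop. 5.5 (i) and descent -/

namespace FrdI.Prop55Sub

open PreFrobenioid

variable {D : Type u} [Category.{v} D] {Φ : Dᵒᵖ ⥤ CommMonCat.{w}}
  {C : Type u'} [Category.{v'} C] {F : C ⥤ ElemFrobenioid Φ}

/-- **Proposition 5.5 (iii), "if `C` is of standard type, then so is `C^pf`"** — the slot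
`Prop55iii_pf_standard F hF` GIVEN (1) Prop. 3.2 (iii) by name (`hPf`), (2) Prop. 5.5 (i) by name at every
object (`h₁`, rows P55-L01/L02) and (3) descent of automorphisms of the images `(A, 1)` of isotropic objects
up to positive powers (`hdesc`, GAP row G-w5d042-1): clause (b) of Def. 3.1 (i) — if `C^pf` is group-like then
so is `C` (`isOfGroupLikeType_ops_iff`), which then has a Frobenius-compact isotropic `A`, whose image
`(A, 1)` is isotropic (Prop. 3.2 (iii)) and Frobenius-compact (`isFrobeniusCompact_toPf_obj`); the other
clauses by `prop55iii_pf_standard_of`.  CONDITIONAL on (1)(2)(3).  [cite: MochizukiFrdI2008, Prop. 5.5 (iii) p.104] -/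
theorem prop55iii_pf_standard_of_descent (hF : IsFrobenioid F)
    (hPf : IsFrobenioid (Perfection.ops hF).toFunctor) (h₁ : ∀ A : C, Prop55i F hF A)
    (hdesc : ∀ A : C, IsIsotropic F A → ∀ f : Aut ((Perfection.toPf hF).obj A),
      ∃ (M : ℕ) (f₀ : Aut A), 0 < M ∧ f ^ M = (Perfection.toPf hF).mapIso f₀) :
    Prop55iii_pf_standard F hF := fun hiso hnorm hS =>
  prop55iii_pf_standard_of hF hPf (fun hGL => by
    obtain ⟨A, hA, hcA⟩ := hS.frobeniusCompact_of_groupLike ((Perfection.isOfGroupLikeType_ops_iff hF).mp hGL)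
    have hA' : IsIsotropic F A := (PreFrobenioidData.ofFunctor_isIsotropic F A).mp hA
    exact ⟨(Perfection.toPf hF).obj A, (Perfection.isOfIsotropicType_perfection hF hiso).obj _,
      Perfection.isFrobeniusCompact_toPf_obj hiso hnorm (h₁ A) hA' hcA (hdesc A hA')⟩) hiso hnorm hS

end FrdI.Prop55Sub


/-! ### Exported unit bookkeeping along `C → C^pf` (for the descent lemma of GAP row G-w5d042-1) -/

namespace PreFrobenioid.Perfection

variable {D : Type u} [Category.{v} D] {Φ : Dᵒᵖ ⥤ CommMonCat.{w}}
  {C : Type u'} [Category.{v'} C] {F : C ⥤ ElemFrobenioid Φ} {hF : IsFrobenioid F}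

/-- `C → C^pf` maps units to units: for `u ∈ O^×(A)`, `toPf(u) ∈ O^×((A, 1))` (Prop. 3.2 (ii): `toPf`
preserves base-identity endomorphisms and Frobenius degrees). [cite: MochizukiFrdI2008, Prop. 3.2 (ii) p.59] -/
theorem toPf_mapIso_mem_unitsSubgroup {A : C} {u : Aut A} (hu : u ∈ unitsSubgroup F A) :
    (toPf hF).mapIso u ∈ (ops hF).unitsSubgroup ((toPf hF).obj A) :=
  ⟨isBaseIdentity_toPf_map hu.1, show Hom.degFr ((toPf hF).map u.hom) = 1 by rw [degFr_toPf]; exact hu.2⟩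

/-- `C → C^pf` is injective on `O^×(A)` UP TO TORSION, for isotropic `A`, GIVEN Prop. 5.5 (i) at `A` by name
(`O^▷(A)^pf ⥲ O^▷((A, 1))` extends `α ↦ toPf(α)`, and `M → M^pf` identifies exactly the pairs with a common
power): `toPf(a) = toPf(b)` for units `a, b` forces `a^K = b^K` for some `K ≥ 1`.
[cite: MochizukiFrdI2008, Prop. 5.5 (i) p.104] -/
theorem pow_eq_pow_of_toPf_mapIso_eq (hiso : IsOfType (IsFrobeniusIsotropic F))
    (hnorm : IsOfType (IsFrobeniusNormalized F)) {A : C} (h₁ : FrdI.Prop55Sub.Prop55i F hF A)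
    (hA : IsIsotropic F A) {a b : Aut A} (ha : a ∈ unitsSubgroup F A) (hb : b ∈ unitsSubgroup F A)
    (hab : (toPf hF).mapIso a = (toPf hF).mapIso b) : ∃ K : ℕ, 0 < K ∧ a ^ K = b ^ K := by
  letI : CommMonoid (endSubmonoid F A) := endCommMonoid F hF A
  obtain ⟨e, he⟩ := h₁ hiso hnorm hA
  have h' : e (Frobenioids.Perfection.of _ ⟨a.hom, ha⟩) = e (Frobenioids.Perfection.of _ ⟨b.hom, hb⟩) :=
    Subtype.ext (by rw [he, he]; exact congrArg Iso.hom hab)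
  obtain ⟨K, hK⟩ := Frobenioids.Perfection.of_eq_of_iff.mp (e.injective h')
  refine ⟨K, K.pos, Iso.ext ?_⟩
  have hK' := congrArg Subtype.val hK
  rw [SubmonoidClass.coe_pow, SubmonoidClass.coe_pow] at hK'
  rw [aut_pow_hom, aut_pow_hom]
  exact hK'

/-- `O^×((A, 1))` is commutative, GIVEN Prop. 5.5 (i) at the isotropic object `A` by name (it is the group of
units of the commutative monoid `O^▷((A,1)) ≅ O^▷(A)^pf`). [cite: MochizukiFrdI2008, Prop. 5.5 (i) p.104] -/
theorem unitsSubgroup_toPf_obj_comm (hiso : IsOfType (IsFrobeniusIsotropic F))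
    (hnorm : IsOfType (IsFrobeniusNormalized F)) {A : C} (h₁ : FrdI.Prop55Sub.Prop55i F hF A)
    (hA : IsIsotropic F A) {u u' : Aut ((toPf hF).obj A)} (hu : u ∈ (ops hF).unitsSubgroup ((toPf hF).obj A))
    (hu' : u' ∈ (ops hF).unitsSubgroup ((toPf hF).obj A)) : u * u' = u' * u := by
  letI : CommMonoid (endSubmonoid F A) := endCommMonoid F hF A
  obtain ⟨e, -⟩ := h₁ hiso hnorm hA
  obtain ⟨x, hx⟩ := e.surjective ⟨u.hom, hu⟩
  obtain ⟨y, hy⟩ := e.surjective ⟨u'.hom, hu'⟩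
  have hc : (⟨u.hom, hu⟩ : (ops hF).endSubmonoid _) * ⟨u'.hom, hu'⟩ = ⟨u'.hom, hu'⟩ * ⟨u.hom, hu⟩ := by
    rw [← hx, ← hy, ← map_mul, ← map_mul, mul_comm]
  exact Iso.ext (congrArg Subtype.val hc)

end PreFrobenioid.Perfection

end Literature.AlgebraicGeometry.Frobenioids
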